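import Summits.Ventures.Crystal3D.Theses.StickyWulffConstant
import Summits.Ventures.Crystal3D.Theorems.StickyWulffConstantNoReconstructionGainOffRegistry
import Summits.Ventures.Crystal3D.Theorems.StickyWulffConstantNoReconstructionGainPeeling
import Summits.Ventures.Crystal3D.Theorems.StickyWulffConstantNoReconstructionGainSampleDeficit
import Summits.Ventures.Crystal3D.StickySpheres.FinsetBridge
import HarnessLib

/-!
# The crux `NoReconstructionGain` BY NAME from the atom, from a certificate, from an off-registry certificate

HONEST FRAMING. Part of the venture `Summits/Ventures/Crystal3D` (cell `crystal3d-full`), helper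
`--supports` the crux `NoReconstructionGain` (stmt-Ventures-19144, route
`route-Ventures-StickyWulffConstant`), line `adhesion`.  Kernel-checked LINE COMPOSITIONS ending in
the route decl `Summit.Ventures.Crystal3D.Theses.StickyWulffConstant.NoReconstructionGain` by name
(each is conditional on ONE named open statement, stated unfolded as its hypothesis):

* `noReconstructionGain_of_adhesion` — the registered skeleton of the line (lead g2, v3): the atom
  `stub_adhesion` ⇒ the crux (with the landed `stub_sampleDeficit`, the split
  `contactDeficiency_sdiff_split` and the `Fin N`/`Finset` bridge);
* `noReconstructionGain_of_potentialCertificate` — cf-p2's `PotentialCertificateExists` ⇒ the crux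
  (`adhesion_of_certificate`, p518005);
* `noReconstructionGain_of_offRegistryCertificate` — certificates for the OFF-LATTICE balls only
  (each with ≤ 3 lattice partners, `fcc_offLattice_unitContacts_le_three`) ⇒ the crux
  (`potentialCertificateExists_of_offRegistry`, p522036).

WHAT THIS IS NOT: a proof of the crux — the hypotheses are open (census R26: no counterexample in
8 037 films); rung F-C1 not moved.
-/

noncomputable section

namespace Summit.Ventures.Crystal3D.Theorems

open Summit.Ventures.Crystal3D Finset
open Literature.MathematicalPhysics.StatisticalMechanics (fccStacking contactDeficiency)
open scoped InnerProductSpace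

/-- **The line's composition: the atom implies the crux.**  (`stub_adhesion` ⇒
`NoReconstructionGain`, by `stub_sampleDeficit` and `D(X) = D(P) + D(X \ P) − #cross`.) -/
theorem noReconstructionGain_of_adhesion
    (hadh : ∃ R C : ℝ, 1 ≤ R ∧ ∀ ν : EuclideanSpace ℝ (Fin 3), ‖ν‖ = 1 → ∀ ρ : ℝ, R ≤ ρ →
      ∀ X P : Finset (EuclideanSpace ℝ (Fin 3)),
      (∀ p ∈ X, ∀ q ∈ X, p ≠ q → 1 ≤ dist p q) → P ⊆ X →
      (∀ p, p ∈ P ↔ (p ∈ fccStacking 1 (Real.sqrt (2 / 3)) ∧ -(2 * R) ≤ ⟪p, ν⟫_ℝ ∧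
        ⟪p, ν⟫_ℝ ≤ -R ∧ ‖p‖ ^ 2 - ⟪p, ν⟫_ℝ ^ 2 ≤ ρ ^ 2)) →
      ((((P ×ˢ (X \ P)).filter fun pq => dist pq.1 pq.2 = 1).card : ℕ) : ℝ) ≤
        contactDeficiency (X \ P) + C * ρ) :
    Summit.Ventures.Crystal3D.Theses.StickyWulffConstant.NoReconstructionGain := by
  classical
  obtain ⟨R, C₁, hR1, hadh⟩ := hadh
  obtain ⟨C₂, hdef⟩ := stub_sampleDeficit R hR1
  refine ⟨R, C₁ + C₂, by linarith, ?_⟩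
  intro ν hν ρ hρ N x hx hsample
  have hxinj : Function.Injective x := hx.injective
  set X : Finset (EuclideanSpace ℝ (Fin 3)) := univ.image x with hX
  set P : Finset (EuclideanSpace ℝ (Fin 3)) := X.filter fun p =>
    p ∈ fccStacking 1 (Real.sqrt (2 / 3)) ∧ -(2 * R) ≤ ⟪p, ν⟫_ℝ ∧ ⟪p, ν⟫_ℝ ≤ -R ∧
      ‖p‖ ^ 2 - ⟪p, ν⟫_ℝ ^ 2 ≤ ρ ^ 2 with hP
  have hXpack : ∀ p ∈ X, ∀ q ∈ X, p ≠ q → 1 ≤ dist p q := by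
    intro p hp q hq hpq
    obtain ⟨i, -, rfl⟩ := mem_image.1 hp
    obtain ⟨j, -, rfl⟩ := mem_image.1 hq
    exact hx.one_le_dist fun hij => hpq (by rw [hij])
  have hPX : P ⊆ X := filter_subset _ _
  have hPiff : ∀ p, p ∈ P ↔ (p ∈ fccStacking 1 (Real.sqrt (2 / 3)) ∧ -(2 * R) ≤ ⟪p, ν⟫_ℝ ∧
      ⟪p, ν⟫_ℝ ≤ -R ∧ ‖p‖ ^ 2 - ⟪p, ν⟫_ℝ ^ 2 ≤ ρ ^ 2) := by
    intro p
    rw [hP, mem_filter]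
    refine ⟨fun h => h.2, fun h => ⟨?_, h⟩⟩
    obtain ⟨i, hi⟩ := hsample p h.1 h.2.1 h.2.2.1 h.2.2.2
    exact mem_image.2 ⟨i, mem_univ _, hi⟩
  have h1 := hadh ν hν ρ hρ X P hXpack hPX hPiff
  have h2 := hdef ν hν ρ hρ P hPiff
  have hsplit := contactDeficiency_sdiff_split hPX
  have hDX : contactDeficiency X = 6 * (N : ℝ) - (numContacts x : ℝ) :=
    contactDeficiency_image_eq x hxinj
  rw [← hDX]
  nlinarith [h1, h2, hsplit, (by linarith : (0 : ℝ) ≤ ρ)]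

/-- **Certificate ⇒ crux.**  cf-p2's `PotentialCertificateExists` (unfolded) implies the crux. -/
theorem noReconstructionGain_of_potentialCertificate
    (h : ∃ R C : ℝ, 1 ≤ R ∧ ∀ ν : EuclideanSpace ℝ (Fin 3), ‖ν‖ = 1 → ∀ ρ : ℝ, R ≤ ρ →
      ∀ X P : Finset (EuclideanSpace ℝ (Fin 3)),
      (∀ p ∈ X, ∀ q ∈ X, p ≠ q → 1 ≤ dist p q) → P ⊆ X →
      (∀ p, p ∈ P ↔ (p ∈ fccStacking 1 (Real.sqrt (2 / 3)) ∧ -(2 * R) ≤ ⟪p, ν⟫_ℝ ∧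
        ⟪p, ν⟫_ℝ ≤ -R ∧ ‖p‖ ^ 2 - ⟪p, ν⟫_ℝ ^ 2 ≤ ρ ^ 2)) →
      ∃ (Φ : EuclideanSpace ℝ (Fin 3) → ℤ) (E : Finset (EuclideanSpace ℝ (Fin 3))),
        E ⊆ X \ P ∧ (E.card : ℝ) ≤ C * ρ ∧
        ∀ q ∈ (X \ P) \ E,
          (((X \ P).filter fun x => dist q x = 1 ∧ Φ x < Φ q).card : ℤ)
              + ((P.filter fun p => dist q p = 1).card : ℤ)
            ≤ (12 - ((X.filter fun x => dist q x = 1).card : ℤ))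
              + (((X \ P).filter fun x => dist q x = 1 ∧ Φ q < Φ x).card : ℤ)) :
    Summit.Ventures.Crystal3D.Theses.StickyWulffConstant.NoReconstructionGain :=
  noReconstructionGain_of_adhesion (adhesion_of_certificate h)

/-- **Off-registry certificate ⇒ crux.**  If around every `ν`-slab sample the OFF-LATTICE film
balls admit an integer potential satisfying (T2) for the enlarged lattice plug off a rim set of
`≤ C ρ` of them (each such ball has at most three plug partners), then `NoReconstructionGain`. -/
theorem noReconstructionGain_of_offRegistryCertificate
    (h : ∃ R C : ℝ, 1 ≤ R ∧ ∀ ν : EuclideanSpace ℝ (Fin 3), ‖ν‖ = 1 → ∀ ρ : ℝ, R ≤ ρ →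
      ∀ X P : Finset (EuclideanSpace ℝ (Fin 3)),
      (∀ p ∈ X, ∀ q ∈ X, p ≠ q → 1 ≤ dist p q) → P ⊆ X →
      (∀ p, p ∈ P ↔ (p ∈ fccStacking 1 (Real.sqrt (2 / 3)) ∧ -(2 * R) ≤ ⟪p, ν⟫_ℝ ∧
        ⟪p, ν⟫_ℝ ≤ -R ∧ ‖p‖ ^ 2 - ⟪p, ν⟫_ℝ ^ 2 ≤ ρ ^ 2)) →
      ∀ O : Finset (EuclideanSpace ℝ (Fin 3)), O ⊆ X \ P →
      (∀ x ∈ (X \ P) \ O, x ∈ fccStacking 1 (Real.sqrt (2 / 3))) →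
      (∀ x ∈ O, x ∉ fccStacking 1 (Real.sqrt (2 / 3))) →
      ∃ (Ψ : EuclideanSpace ℝ (Fin 3) → ℤ) (E : Finset (EuclideanSpace ℝ (Fin 3))),
        E ⊆ O ∧ (E.card : ℝ) ≤ C * ρ ∧
        ∀ q ∈ O \ E,
          (((X \ (X \ O)).filter fun x => dist q x = 1 ∧ Ψ x < Ψ q).card : ℤ)
              + (((X \ O).filter fun p => dist q p = 1).card : ℤ)
            ≤ (12 - ((X.filter fun x => dist q x = 1).card : ℤ))
              + (((X \ (X \ O)).filter fun x => dist q x = 1 ∧ Ψ q < Ψ x).card : ℤ)) :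
    Summit.Ventures.Crystal3D.Theses.StickyWulffConstant.NoReconstructionGain :=
  noReconstructionGain_of_potentialCertificate (potentialCertificateExists_of_offRegistry h)

end Summit.Ventures.Crystal3D.Theorems
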